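import Summits.BirchSwinnertonDyer.BirchSwinnertonDyer.Theorems.CMKolyvaginAtInertTwoCMKolyvaginConjectureAtInertTwoPositiveDepthGenusCharacterDescent
import HarnessLib

/-!
# Crux `CMKolyvaginConjectureAtInertTwo` (stmt-BirchSwinnertonDyer-24648), open stub `stub_positiveDepth`:
# THE GENUS-CHARACTER HEEGNER POINT `y_{χ_θ}` ITSELF IS THE TRANSPORT OF A `K`-RATIONAL POINT OF `E^{(ℓ*)}`

Route `CMKolyvaginAtInertTwo` (cell `pub/bsd-eis`, seat `leafhand-bsd-cmkolyvaginatinert-4` g0); helper (`--supports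
stmt-BirchSwinnertonDyer-24648 --as helper`). THEOREMS ONLY (no definition, no named fact, no `sorry`); closes nothing; BSD is
proved for no curve. Sequel of `…PositiveDepthGenusCharacterDescent.lean` (this seat): there the clause `P(ℓ) ∈ 2E(K[ℓ])` became
«`y_χ = 4R` with `R ∈ ι_θ(E^{(ℓ*)}(K)) ∪ {O}`». Here the same descent is applied to `y_χ = Σ_{g ∈ Gal(K[ℓ]/K)} χ(g)·g y(ℓ)` itself
(it is `χ`-equivariant, §1 of the predecessor), so that BOTH sides of the clause live in the Mordell–Weil group of ONE quadratic
twist over the FIXED field `K`: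

* `chiSum_eq_zero_or_rational_twistCoords` — at any level `n ≠ 0` (no frame hypothesis beyond `K` imaginary quadratic):
  for `θ ∈ K[ℓ]`, `θ ≠ 0`, `θ² = c ∈ ℚ`, `χ = χ_θ`: `y_χ = O` or `y_χ = (x, y)` with `x = ι k₁`, `(2y + a₁x + a₃)/θ = ι k₂` and
  `c·k₂² = 4k₁³ + b₂k₁² + 2b₄k₁ + b₆` in `K` — `y_χ = ι_θ(k₁, k₂)` for a point `(k₁, k₂) ∈ E^{(c)}(K)`.
* `stub_clause_iff_in_twist_over_K` — on the stub's frame at a CM-inert Zhang–Kolyvagin prime `ℓ` with `θ² = ℓ*`, `σ_ℓθ = −θ`: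
  the conjunction «`y_χ ∈ ι_θ(E^{(ℓ*)}(K)) ∪ {O}`» ∧ «`P(ℓ) ∈ 2E(K[ℓ]) ⟺ y_χ ∈ 4·(ι_θ(E^{(ℓ*)}(K)) ∪ {O})`», i.e. the prime-level
  clause of Kolyvagin's conjecture at CM-inert `2` is the statement «the `K`-rational point `y'_ℓ ∈ E^{(ℓ*)}(K)` transported to
  `y_{χ_θ}` is not `4`-divisible in `E^{(ℓ*)}(K)`» (`ι_θ` is an injective group homomorphism on `E^{(ℓ*)}(K(θ))`, Silverman X.2.4 /
  X.5.4; the group law of the twist is not needed for the statement and is not built here).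

HONEST FRAMING: two short compositions; the non-vanishing is untouched; no stub or item is closed; BSD is proved for no curve.
References: [cite: GrossLMS1991, §3 (3.5), §4 (4.1)] [cite: SilvermanAEC2009, X.2 Prop. 2.4, X.5 Cor. 5.4] [cite: Cox2013, §9.A].
-/

set_option linter.dupNamespace false -- `Summit.BirchSwinnertonDyer.BirchSwinnertonDyer.Theorems.…` (summit = sub)
set_option autoImplicit false

noncomputable section

open scoped Classical

namespace Summit.BirchSwinnertonDyer.BirchSwinnertonDyer.Theorems.CMKolyvaginConjecturePositiveDepth

open Finset WeierstrassCurve NumberField Literature.NumberTheory.EllipticCurves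
  Literature.NumberTheory.EllipticCurves.ModularForms
  Literature.NumberTheory.EllipticCurves.Rank1Residual

variable {K : Type} [Field K] [NumberField K]

/-- **`y_{χ_θ}` is the transport of a `K`-rational point of the twist.** `K` imaginary quadratic, `ι : K → ℂ`, `n ≠ 0`, any curve
`W/ℚ` and any point `P ∈ E(K[n])`; `θ ∈ K[n]` with `θ ≠ 0`, `θ² = c ∈ ℚ`, and `χ = χ_θ` its sign character (`χ(g) = 1` if `gθ = θ`,
`−1` otherwise): the character sum `y_χ = Σ_{g ∈ Gal(K[n]/K)} χ(g)·g P` is `O` or an affine point `(x, y)` with `x = ι k₁`,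
`(2y + a₁x + a₃)/θ = ι k₂` for `k₁, k₂ ∈ K` satisfying `c·k₂² = 4k₁³ + b₂k₁² + 2b₄k₁ + b₆` — a point of `E^{(c)}(K)`.
(`y_χ` is `χ`-equivariant, `apply_finsum_chi_smul_eq_chi_smul`; then `coords_fixed_of_chiTheta_equivariant`, the Galois
correspondence `coe_mem_range_of_forall_mem_ringClassGal`, and `exists_rational_twistPoint_of_coords_mem_range`.)
[cite: SilvermanAEC2009, X.2 Prop. 2.4 (proof), X.5 Cor. 5.4] [cite: Cox2013, §9.A] -/
theorem chiSum_eq_zero_or_rational_twistCoords (hK : IsImaginaryQuadratic K) (W : WeierstrassCurve ℚ) {ι : K →+* ℂ} {n : ℕ}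
    (hn : n ≠ 0) {θ : ringClassField K ι n} (hθ : θ ≠ 0) {c : ℚ} (hθ2 : θ ^ 2 = algebraMap ℚ (ringClassField K ι n) c)
    (χ : (ringClassField K ι n ≃ₐ[ℚ] ringClassField K ι n) → ℤ) (hχp : ∀ g, g θ = θ → χ g = 1)
    (hχn : ∀ g, g θ ≠ θ → χ g = -1) (P : (W.baseChange (ringClassField K ι n)).toAffine.Point) :
    ∀ (x y : ringClassField K ι n) (h : (W.baseChange (ringClassField K ι n)).toAffine.Nonsingular x y),
      (∑ᶠ g ∈ (ringClassGal ι n : Set (ringClassField K ι n ≃ₐ[ℚ] ringClassField K ι n)),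
          χ g • pointGalHom W (ringClassField K ι n) g P) = .some x y h →
        ∃ k₁ k₂ : K, ι k₁ = x ∧
          ι k₂ = (((2 * y + (W.baseChange (ringClassField K ι n)).toAffine.a₁ * x +
            (W.baseChange (ringClassField K ι n)).toAffine.a₃) / θ : ringClassField K ι n) : ℂ) ∧
          (c : K) * k₂ ^ 2 = 4 * k₁ ^ 3 + (W.b₂ : K) * k₁ ^ 2 + 2 * (W.b₄ : K) * k₁ + (W.b₆ : K) := by
  intro x y h hsum
  -- `Aut_ℚ(K[n])` is finite (`K[n]/K` finite Galois, `K/ℚ` finite)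
  haveI := (finiteDimensional_and_isGalois_ringClassField hK ι hn).1
  haveI : FiniteDimensional ℚ (ringClassField K ι n) := Module.Finite.trans K (ringClassField K ι n)
  haveI : Finite (ringClassField K ι n ≃ₐ[ℚ] ringClassField K ι n) := Finite.of_fintype _
  have heq : ∀ g ∈ ringClassGal ι n, pointGalHom W (ringClassField K ι n) g (.some x y h) = χ g • (.some x y h) := by
    intro g hg
    rw [← hsum]
    exact apply_finsum_chi_smul_eq_chi_smul (pointGalHom W (ringClassField K ι n)) (ringClassGal ι n) χ
      (fun g _ g' _ ↦ chiTheta_mul hθ hθ2 χ hχp hχn g g') (fun g _ ↦ chiTheta_eq_one_or θ χ hχp hχn g) hg P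
  have hfix := coords_fixed_of_chiTheta_equivariant W hθ hθ2 χ hχp hχn (ringClassGal ι n) h heq
  exact exists_rational_twistPoint_of_coords_mem_range W hθ hθ2 h.left
    (coe_mem_range_of_forall_mem_ringClassGal hK ι hn x fun g hg ↦ (hfix g hg).1)
    (coe_mem_range_of_forall_mem_ringClassGal hK ι hn _ fun g hg ↦ (hfix g hg).2)

/-- **The prime-level clause of the stub, entirely inside `E^{(ℓ*)}` over `K`.** On H₂ (`W/ℚ` globally minimal with CM, `2` inert in
`F`, `ρ̄_{E,2}` onto), `K` imaginary quadratic with odd `d_K ≠ −3` and Heegner for `N_E`, `ℓ` a CM-inert Zhang–Kolyvagin prime at `2`,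
`d` any datum of conductor `ℓ`, `θ ∈ K[ℓ]` with `θ ≠ 0`, `θ² = c ∈ ℚ`, `σ_ℓθ = −θ` (exists with `c = ℓ*`), `χ = χ_θ`: writing
`T := {O} ∪ {(x, y) ∈ E(K[ℓ]) : x = ι k₁, (2y + a₁x + a₃)/θ = ι k₂, c·k₂² = 4k₁³ + b₂k₁² + 2b₄k₁ + b₆, k₁, k₂ ∈ K} = ι_θ(E^{(c)}(K)) ∪ {O}`,
BOTH `y_χ ∈ T` AND (`P_d(ℓ) ∈ 2E(K[ℓ]) ⟺ y_χ = 4R` for some `R ∈ T`). So Kolyvagin's clause at a CM-inert prime is: the point of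
`E^{(ℓ*)}(K)` carried by the genus Heegner point `y_{χ_θ}` is not `4` times (the transport of) a point of `E^{(ℓ*)}(K)`.
[cite: GrossLMS1991, §3 (3.5), §4 (4.1)] [cite: SilvermanAEC2009, X.5 Cor. 5.4] [cite: Cox2013, Thm. 9.18, §9.A] -/
theorem chiSum_rational_and_two_dvd_derivedPoint_iff (W : WeierstrassCurve ℚ) [W.IsElliptic]
    [W.IsGloballyMinimal] [NeZero (W.conductorNorm ℤ)] (hCM : W.HasCM) (hin : CMInert W 2)
    (hρ : W.HasSurjectiveModNGaloisRep (2 : ℤ)) (hK : IsImaginaryQuadratic K)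
    (hodd : Odd (NumberField.discr K)) (h3 : NumberField.discr K ≠ -3)
    (hH : SatisfiesHeegnerHypothesis (W.conductorNorm ℤ) K)
    {Dt : ModularParametrizationData W (W.conductorNorm ℤ)} {β : ℤ} {ι : K →+* ℂ} {ℓ : ℕ}
    (hℓK : Zhang2014.IsKolyvaginPrime (W.conductorNorm ℤ) W K 2 ℓ) (hℓF : CMInert W ℓ)
    (d : KolyvaginHeegnerData Dt β ι ℓ) {θ : ringClassField K ι ℓ} (hθ : θ ≠ 0) {c : ℚ}
    (hθ2 : θ ^ 2 = algebraMap ℚ (ringClassField K ι ℓ) c) (hσθ : d.σ ℓ θ = -θ)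
    (χ : (ringClassField K ι ℓ ≃ₐ[ℚ] ringClassField K ι ℓ) → ℤ) (hχp : ∀ g, g θ = θ → χ g = 1)
    (hχn : ∀ g, g θ ≠ θ → χ g = -1) :
    (∀ (x y : ringClassField K ι ℓ) (h : (W.baseChange (ringClassField K ι ℓ)).toAffine.Nonsingular x y),
      (∑ᶠ g ∈ (ringClassGal ι ℓ : Set (ringClassField K ι ℓ ≃ₐ[ℚ] ringClassField K ι ℓ)),
          χ g • pointGalHom W (ringClassField K ι ℓ) g d.y) = .some x y h →
        ∃ k₁ k₂ : K, ι k₁ = x ∧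
          ι k₂ = (((2 * y + (W.baseChange (ringClassField K ι ℓ)).toAffine.a₁ * x +
            (W.baseChange (ringClassField K ι ℓ)).toAffine.a₃) / θ : ringClassField K ι ℓ) : ℂ) ∧
          (c : K) * k₂ ^ 2 = 4 * k₁ ^ 3 + (W.b₂ : K) * k₁ ^ 2 + 2 * (W.b₄ : K) * k₁ + (W.b₆ : K)) ∧
    ((∃ Q : (W.baseChange (ringClassField K ι ℓ)).toAffine.Point, (2 : ℤ) • Q = d.derivedPoint) ↔
      ∃ R : (W.baseChange (ringClassField K ι ℓ)).toAffine.Point,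
        (4 : ℤ) • R =
          ∑ᶠ g ∈ (ringClassGal ι ℓ : Set (ringClassField K ι ℓ ≃ₐ[ℚ] ringClassField K ι ℓ)),
            χ g • pointGalHom W (ringClassField K ι ℓ) g d.y ∧
        ∀ (x y : ringClassField K ι ℓ) (h : (W.baseChange (ringClassField K ι ℓ)).toAffine.Nonsingular x y),
          R = .some x y h →
            ∃ k₁ k₂ : K, ι k₁ = x ∧
              ι k₂ = (((2 * y + (W.baseChange (ringClassField K ι ℓ)).toAffine.a₁ * x +
                (W.baseChange (ringClassField K ι ℓ)).toAffine.a₃) / θ : ringClassField K ι ℓ) : ℂ) ∧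
              (c : K) * k₂ ^ 2 = 4 * k₁ ^ 3 + (W.b₂ : K) * k₁ ^ 2 + 2 * (W.b₄ : K) * k₁ + (W.b₆ : K)) := by
  refine ⟨chiSum_eq_zero_or_rational_twistCoords hK W hℓK.1.ne_zero hθ hθ2 χ hχp hχn d.y, ?_⟩
  rw [two_dvd_derivedPoint_iff_exists_rational_twistCoords W hCM hin hρ hK hodd h3 hH hℓK hℓF d hθ hθ2 hσθ χ hχp hχn]
  refine exists_congr fun R ↦ and_congr_right fun _ ↦ forall₃_congr fun x y h ↦ imp_congr_right fun _ ↦ ?_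
  constructor
  · rintro ⟨hx, hw⟩
    exact exists_rational_twistPoint_of_coords_mem_range W hθ hθ2 h.left hx hw
  · rintro ⟨k₁, k₂, hk₁, hk₂, -⟩
    exact ⟨⟨k₁, hk₁⟩, ⟨k₂, hk₂⟩⟩

end Summit.BirchSwinnertonDyer.BirchSwinnertonDyer.Theorems.CMKolyvaginConjecturePositiveDepth

end
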